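/-
Copyright (c) 2026 the pub-hodgecm-mathlib formalisation cell (harness21).  Prover seat hodgecm-mathlib-F0P3b-p01 (g13): «S3-ram» seeding wave (LEAD F0P3a-plan (g12)
T11-41; owner F0P3a-p06 (g15)), row «P-1-ram (i) (N1) RAMIFIED LITERALS», sequel «κ-SIGNS»; 2026-09-01.
-/
import Literature.NumberTheory.Rogawski1990.ExplicitFactorKappaAlmostEverywhereOne          -- ★ `conjLocal_apply_eq_galAdicCompletionMap`; brings ★ `finKappaAt_eq_ite_of_eigenvector`, `isUnit_localRing_of_ne_zero_of_subsingleton`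
import Literature.NumberTheory.Automorphic.AnisotropicUnitaryGroupCompactOfPlace            -- ★ `localGram_apply_apply`
import Literature.NumberTheory.Automorphic.UnitaryGroupInertPlaceHyperbolicBasis            -- ★ `placeForm_hermitian_of_smul_eq`
import Literature.NumberTheory.Rogawski1990.UnitFundamentalLemmaFrameOfFormCongr           -- ★ p846897 (one-place frame currency `localNonsplitEquiv`, `glInt`)
import Literature.NumberTheory.Rogawski1990.LocalStableClassesNonsplit                       -- ★ B-p04: `twistGram_eigenframe_apply_ne_zero`
import Literature.NumberTheory.Automorphic.UnitaryThreeUnipotentClassesRamifiedPlace         -- ★ p846845: `exists_fixed_unit_norm_dichotomy_of_ramified_complexConj`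
import Literature.NumberTheory.Automorphic.UnitaryDiagonalUnitFormsIntegralFramesRamified     -- ★ p846940 (p08 (g19))
import HarnessLib

/-!
# The κ-sign of a type-(1) class read in a ONE-PLACE frame at a non-split place: `κ_v(γ_H, t) = +1 ⟺ ⟨q_j, q_j⟩_{H′_w}` is a norm, and for the frame
# transports `t_b = e⁻¹(P_b · diag(x) · P_b⁻¹)` of the ramified literals `κ_v(γ_H, t_b) = χ(−det H′_w · ε^b₁)` (Rogawski 1990 §4.3 (4.3.2), §3.5 Prop. 3.5.2)

Topic `NumberTheory/Rogawski1990`; namespace `Literature.NumberTheory.Rogawski1990`.  KERNEL mathematics only: theorems, no definition, no named fact, no instance,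
no notation, no `sorry`.  Cell `pub/hodgecm-mathlib`, crux H413 (`--supports stmt-HodgeConjecture-24833`), «S3-ram» seeding wave (LEAD T11-41, owner F0P3a-p06 (g15)),
row «P-1-ram (i) (N1)», sequel «κ-SIGNS» (consumer: A-p16 (g31)'s STUB A′ (iii) κ-ram cancellation; B-p14 (g38)'s certificate label `κ_b = (−1)^{b₁}`).
HONEST LABEL: HC_CM is proved only modulo the 2 remaining named inputs (hLiu418 24832, h413 24833) until rung 0 closes; this file has no books consequence.

THE MATHEMATICS.  [Rogawski1990, §4.3 (4.3.2), §3.5 Prop. 3.5.2 (c), §4.9 Prop. 4.9.1]: for a matched pair `(γ_H, t)` with `γ_H = (g, u)` `G`-regular, `κ_v(γ_H, t) = +1`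
iff the `H′`-length of a `u`-eigenvector of `t` is a norm (★ `finKappaAt_eq_ite_of_eigenvector`, semilocal carriers).  §1 reads this in the ONE-PLACE model at a
non-split `v` (one `w ∣ v`): if `t_w · Q = Q · diag(x)` in `GL₃(L_w)` with `x_j = u_w`, then `κ_v(γ_H, t) = +1 ⟺ ∃ z ∈ L_w, σ_w(z) z = (ᵗσ̄_w Q · H′_w · Q)_{jj}`
(**`finKappaAt_eq_ite_of_onePlace_frame`**; the eigenvector is the `j`-th column of `Q`, lifted to `E_v = ∏_{w′∣v} L_{w′}` along the unique place).  §2: in the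
«S3-ram» frame `H′_w = (−det H′_w) • ᵗσ̄A J₀ A` with a literal frame `ᵗσ̄P J₀ P = diag(D)`, the frame `Q = A⁻¹P` of `t_w = A⁻¹ (P diag(x) P⁻¹) A` has
`(ᵗσ̄Q H′_w Q)_{jj} = (−det H′_w) · D_j` (`formCongr_inv_mul_apply_of_frame`), so for the four ramified representatives of ★
`forall_ramified_representatives_of_frames` (`D = (ε^b₀, ε^b₁, −ε^(b₀+b₁))`, `j = 1`): **`κ_v(γ_H, t_b) = +1 ⟺ (−det H′_w)·ε^b₁ ∈ N(L_w^×)`**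
(`finKappaAt_eq_ite_of_literal_frame`), and with `ε` a NON-norm and the norm dichotomy of ★ `exists_fixed_unit_norm_dichotomy_of_ramified_complexConj`
(index two) the sign FLIPS with `b₁`: `κ_v(γ_H, t_{b₀,1}) = −κ_v(γ_H, t_{b₀,0})` (`finKappaAt_eq_neg_of_literal_frames`) — two classes of each sign, as the
κ-count ★ `ncard_conjClassesIn_sep_finKappaAt_eq_{eq,neg}_two` predicts.

## References
* [Rogawski1990] J. D. Rogawski, *Automorphic Representations of Unitary Groups in Three Variables*, Ann. of Math. Stud. 123 (1990), §3.5 Prop. 3.5.2 (c) p. 29, §4.3 (4.3.2)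
  p. 43, §4.9 Prop. 4.9.1 p. 55.
* [LanglandsShelstad1987] R. P. Langlands, D. Shelstad, *On the definition of transfer factors*, Math. Ann. 278 (1987), §1.
* [LabesseLanglands1979] J.-P. Labesse, R. P. Langlands, *L-indistinguishability for SL(2)*, Canad. J. Math. 31 (1979), §2 pp. 8–9.
-/

set_option autoImplicit false

noncomputable section

open NumberField IsDedekindDomain Matrix Topology
open scoped Matrix MatrixGroups Classical

namespace Literature.NumberTheory.Rogawski1990

open Literature.NumberTheory.Automorphic Literature.NumberTheory.Automorphic.UnitaryGroup

section CM

variable (L : Type) [Field L] [NumberField L] [IsCMField L] (H' : Matrix (Fin 3) (Fin 3) L)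
  {v : HeightOneSpectrum (𝓞 ↥(maximalRealSubfield L))}

/-! ## §1 `κ_v` read on a one-place eigenframe -/

/-- **`κ_v(γ_H, t)` IN A ONE-PLACE FRAME.**  `v` non-split (`c • w = w`), `(γ_H, t)` matched with `χ_g(u)` a unit (`G`-regular), and `t_w · Q = Q · diag(x)` an eigenframe
of the `w`-component of `t` in `GL₃(L_w)` with `x_j = u_w`.  Then `κ_v(γ_H, t) = +1` iff the `H′_w`-length `(ᵗσ̄_w Q · H′_w · Q)_{jj}` of the `j`-th frame vector is a
norm `σ_w(z) z`, `z ∈ L_w`.  (★ `finKappaAt_eq_ite_of_eigenvector` with the eigenvector `q_j` lifted to `E_v` along the unique place `w`.)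
[cite: Rogawski1990, §4.3 (4.3.2) p. 43; §3.5 Prop. 3.5.2 (c) p. 29; §4.9 Prop. 4.9.1 p. 55] [cite: LanglandsShelstad1987, §1] -/
theorem finKappaAt_eq_ite_of_onePlace_frame (w : PlacesOver L v) (hw : IsCMField.complexConj L • w.1 = w.1)
    (γH : (cmDatum L 2 (Matrix.of fun i j : Fin 2 => if i.val + j.val + 1 = 2 then (1 : L) else 0)).Local v ×
      (cmDatum L 1 (Matrix.of fun i j : Fin 1 => if i.val + j.val + 1 = 1 then (1 : L) else 0)).Local v)
    (hu : IsUnit ((finCharpolyTwo L v γH).eval (finGammaTwo L v γH))) (hH'w : IsUnit (placeForm H' w.1))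
    {t : (cmDatum L 3 H').Local v} (ht : IsLocalNormPair L H' v γH t)
    {Q : GL (Fin 3) (w.1.adicCompletion L)} {x : Fin 3 → w.1.adicCompletion L}
    (hQ : (((localNonsplitEquiv (IsCMField.complexConj L) H' (IsCMField.complexConj_ne_one L) w hw t).val :
        GL (Fin 3) (w.1.adicCompletion L)) : Matrix (Fin 3) (Fin 3) (w.1.adicCompletion L)) * Q.val = Q.val * diagonal x)
    (hx : Function.Injective x) (hx1 : ∀ i, galAdicCompletionMap (L := L) (IsCMField.complexConj L) hw (x i) * x i = 1)
    {j : Fin 3} (hj : x j = finGammaTwo L v γH w) :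
    finKappaAt L v H' γH t =
      if ∃ z : w.1.adicCompletion L, galAdicCompletionMap (L := L) (IsCMField.complexConj L) hw z * z =
          formCongr (galAdicCompletionMap (L := L) (IsCMField.complexConj L) hw) Q (placeForm H' w.1) j j
      then 1 else -1 := by
  classical
  have hc := IsCMField.complexConj_ne_one L
  haveI : Algebra.IsQuadraticExtension ↥(maximalRealSubfield L) L := IsCMField.isQuadraticExtension L
  have hvs : Subsingleton (PlacesOver L v) := PlacesOver.subsingleton_of_smul_eq (IsCMField.complexConj L) hc w hw
  letI : Unique (PlacesOver L v) := @uniqueOfSubsingleton _ hvs w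
  -- the `w`-component of `t` is the one-place model matrix
  have htw : ∀ i k, (t.val.val : Matrix (Fin 3) (Fin 3) (UnitaryGroup.LocalRing L v)) i k w =
      (((localNonsplitEquiv (IsCMField.complexConj L) H' hc w hw t).val : GL (Fin 3) (w.1.adicCompletion L)) :
        Matrix (Fin 3) (Fin 3) (w.1.adicCompletion L)) i k := fun i k => by
    have h := congr_fun (congr_fun (coe_localNonsplitEquiv_apply L H' v w hw t) i) k
    rw [h, Matrix.map_apply]; rfl
  -- the eigenvector: the `j`-th column of `Q`, lifted along the unique place
  obtain ⟨p', hp'w⟩ : ∃ p' : Fin 3 → UnitaryGroup.LocalRing L v, ∀ i, p' i w = Q.val i j :=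
    ⟨fun i => (RingEquiv.piUnique fun w' : PlacesOver L v => w'.1.adicCompletion L).symm (Q.val i j),
      fun i => (RingEquiv.piUnique fun w' : PlacesOver L v => w'.1.adicCompletion L).apply_symm_apply _⟩
  have hne : p' ≠ 0 := fun h0 => by
    have hcol : ∀ i, Q.val i j = 0 := fun i => by rw [← hp'w i, h0, Pi.zero_apply, Pi.zero_apply]
    have hdet : Q.val.det = 0 := Matrix.det_eq_zero_of_column_eq_zero j hcol
    exact (Matrix.isUnits_det_units Q).ne_zero hdet
  have hp' : (t.val.val : Matrix (Fin 3) (Fin 3) (UnitaryGroup.LocalRing L v)) *ᵥ p' = finGammaTwo L v γH • p' := by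
    funext i
    rw [LocalRing.eq_iff_apply_eq (IsCMField.complexConj L) hc w hw]
    simp only [Matrix.mulVec, dotProduct, Finset.sum_apply, Pi.mul_apply, Pi.smul_apply, smul_eq_mul, htw, hp'w]
    have h := congr_fun (congr_fun hQ i) j
    rw [Matrix.mul_apply, Matrix.mul_diagonal] at h
    rw [h, ← hj, mul_comm]
  -- the `H′`-value of `p′` is `(ᵗσ̄Q H′_w Q)_{jj}`
  have hxw : (∑ i : Fin 3, ∑ k : Fin 3, UnitaryGroup.conjLocal L (IsCMField.complexConj L) v (p' i) *
      ((UnitaryGroup.adelicForm L 3 H').map (UnitaryGroup.adeleToLocal L v)) i k * p' k) w =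
        formCongr (galAdicCompletionMap (L := L) (IsCMField.complexConj L) hw) Q (placeForm H' w.1) j j := by
    simp only [Finset.sum_apply, Pi.mul_apply, conjLocal_apply_eq_galAdicCompletionMap L v w hw, localGram_apply_apply, hp'w]
    rw [Finset.sum_comm]
    simp only [formCongr, Matrix.mul_apply, Matrix.transpose_apply, Matrix.map_apply, Finset.sum_mul]
  rw [finKappaAt_eq_ite_of_eigenvector L v H' γH t hvs ht hu hp' hne]
  -- the two norm conditions agree (read at the single place `w`)
  have hiff : (∃ z : UnitaryGroup.LocalRing L v, IsUnit z ∧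
      (∑ i : Fin 3, ∑ k : Fin 3, UnitaryGroup.conjLocal L (IsCMField.complexConj L) v (p' i) *
        ((UnitaryGroup.adelicForm L 3 H').map (UnitaryGroup.adeleToLocal L v)) i k * p' k) =
        z * UnitaryGroup.conjLocal L (IsCMField.complexConj L) v z) ↔
      ∃ z : w.1.adicCompletion L, galAdicCompletionMap (L := L) (IsCMField.complexConj L) hw z * z =
        formCongr (galAdicCompletionMap (L := L) (IsCMField.complexConj L) hw) Q (placeForm H' w.1) j j := by
    constructor
    · rintro ⟨z, -, hz⟩
      refine ⟨z w, ?_⟩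
      have h := congr_fun hz w
      rw [hxw, Pi.mul_apply, conjLocal_apply_eq_galAdicCompletionMap L v w hw] at h
      rw [mul_comm]; exact h.symm
    · rintro ⟨z, hz⟩
      -- the frame length is non-zero (eigenlines of a type-(1) unitary element are non-degenerate), so `z ≠ 0`
      have hval0 : formCongr (galAdicCompletionMap (L := L) (IsCMField.complexConj L) hw) Q (placeForm H' w.1) j j ≠ 0 := by
        have hHd : (placeForm H' w.1).det ≠ 0 := ((Matrix.isUnit_iff_isUnit_det _).1 hH'w).ne_zero
        have hγ : ((localNonsplitEquiv (IsCMField.complexConj L) H' hc w hw t).val : GL (Fin 3) (w.1.adicCompletion L)) ∈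
            Literature.AlgebraicGeometry.ShimuraVarieties.unitaryGroup (galAdicCompletionMap (L := L) (IsCMField.complexConj L) hw) (placeForm H' w.1) := by
          rw [Literature.AlgebraicGeometry.ShimuraVarieties.unitaryGroup_eq_unitaryGroupOfForm]
          exact (localNonsplitEquiv (IsCMField.complexConj L) H' hc w hw t).2
        exact twistGram_eigenframe_apply_ne_zero _ _ hHd hγ hQ hx hx1 j
      have hz0 : z ≠ 0 := fun h0 => hval0 (by rw [← hz, h0, mul_zero])
      refine ⟨(RingEquiv.piUnique fun w' : PlacesOver L v => w'.1.adicCompletion L).symm z, ?_, ?_⟩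
      · exact isUnit_localRing_of_ne_zero_of_subsingleton L v hvs fun h0 => hz0 (by
          have h := congr_fun h0 w
          rwa [show ((RingEquiv.piUnique fun w' : PlacesOver L v => w'.1.adicCompletion L).symm z) w = z from
            (RingEquiv.piUnique fun w' : PlacesOver L v => w'.1.adicCompletion L).apply_symm_apply _] at h)
      · rw [LocalRing.eq_iff_apply_eq (IsCMField.complexConj L) hc w hw, hxw, Pi.mul_apply, conjLocal_apply_eq_galAdicCompletionMap L v w hw,
          show ((RingEquiv.piUnique fun w' : PlacesOver L v => w'.1.adicCompletion L).symm z) w = z from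
            (RingEquiv.piUnique fun w' : PlacesOver L v => w'.1.adicCompletion L).apply_symm_apply _, mul_comm, hz]
  exact if_congr hiff rfl rfl

/-! ## §2 The «S3-ram» frame: lengths `(−det H′_w)·D_j`, the κ-sign of a ramified literal, and the flip with `b₁` -/

/-- **ONE-PLACE EIGENFRAME OF `t` FROM THE FRAME `e`**: if `E = A · t_w · A⁻¹` (clause (i) of ★ p846897 at `g := t`) and `E · P = P · diag(x)` (the literal's eigenframe),
then `t_w · (A⁻¹P) = (A⁻¹P) · diag(x)`. [cite: Rogawski1990, §3.5 p. 29] -/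
theorem onePlace_frame_of_conj_frame {K : Type*} [CommRing K] {E tw A P : GL (Fin 3) K} {x : Fin 3 → K} (hE : E = A * tw * A⁻¹)
    (hEP : E.val * P.val = P.val * diagonal x) : tw.val * (A⁻¹ * P).val = (A⁻¹ * P).val * diagonal x := by
  have h1 : tw * (A⁻¹ * P) = A⁻¹ * (E * P) := by rw [hE]; group
  rw [← Units.val_mul, h1, Units.val_mul, Units.val_mul, hEP, ← Matrix.mul_assoc, ← Units.val_mul]

/-- **LENGTHS IN THE FOLD'S FRAME**: if `H′_w = (−det H′_w) • ᵗσ̄A J₀ A` (binder `hframe`) and `ᵗσ̄P J₀ P = diag(D)`, then `ᵗσ̄(A⁻¹P) H′_w (A⁻¹P) = (−det H′_w) • diag(D)`;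
in particular its `(j,j)` entry is `(−det H′_w) · D_j`. [cite: Rogawski1990, §3.5 Prop. 3.5.2 p. 29] [cite: Jacobowitz1962, §8] -/
theorem formCongr_inv_mul_eq_smul_diagonal_of_frame (w : PlacesOver L v) (hw : IsCMField.complexConj L • w.1 = w.1)
    (A : GL (Fin 3) (w.1.adicCompletion L))
    (hframe : placeForm H' w.1 = (-(placeForm H' w.1).det) •
      formCongr (galAdicCompletionMap (L := L) (IsCMField.complexConj L) hw) A ((StdForm.antidiagonal 3).over (w.1.adicCompletion L)))
    {P : GL (Fin 3) (w.1.adicCompletion L)} {D : Fin 3 → w.1.adicCompletion L}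
    (hPD : formCongr (galAdicCompletionMap (L := L) (IsCMField.complexConj L) hw) P ((StdForm.antidiagonal 3).over (w.1.adicCompletion L)) = diagonal D) :
    formCongr (galAdicCompletionMap (L := L) (IsCMField.complexConj L) hw) (A⁻¹ * P) (placeForm H' w.1) = (-(placeForm H' w.1).det) • diagonal D := by
  set σ := galAdicCompletionMap (L := L) (IsCMField.complexConj L) hw
  have h1 : formCongr σ (A⁻¹ * P) (placeForm H' w.1) = formCongr σ P (formCongr σ A⁻¹ (placeForm H' w.1)) := by
    simp only [formCongr, Units.val_mul, Matrix.map_mul, Matrix.transpose_mul, Matrix.mul_assoc]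
  have h2 : formCongr σ A⁻¹ (placeForm H' w.1) = (-(placeForm H' w.1).det) • (StdForm.antidiagonal 3).over (w.1.adicCompletion L) := by
    conv_lhs => rw [hframe]
    rw [show ∀ (c : w.1.adicCompletion L) (M : Matrix (Fin 3) (Fin 3) (w.1.adicCompletion L)), formCongr σ A⁻¹ (c • M) = c • formCongr σ A⁻¹ M from
      fun c M => by simp only [formCongr, Matrix.mul_smul, Matrix.smul_mul], formCongr_inv_formCongr]
  rw [h1, h2, show ∀ (c : w.1.adicCompletion L) (M : Matrix (Fin 3) (Fin 3) (w.1.adicCompletion L)), formCongr σ P (c • M) = c • formCongr σ P M from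
      fun c M => by simp only [formCongr, Matrix.mul_smul, Matrix.smul_mul], hPD]

/-- **THE κ-SIGN OF A RAMIFIED LITERAL**: in the setting of ★ `forall_ramified_representatives_of_frames` — `t ∈ G′_v` matched with the `G`-regular `γ_H = (g, u)`, the
one-place eigenframe `t_w · (A⁻¹P) = (A⁻¹P) · diag(x)` (★ `onePlace_frame_of_conj_frame` from clauses (i) + «eigenframe»), `x_j = u_w`, `ᵗσ̄P J₀ P = diag(D)` —
`κ_v(γ_H, t) = +1 ⟺ (−det H′_w) · D_j` is a norm `σ_w(z) z`.  For the four literals `D = (ε^b₀, ε^b₁, −ε^(b₀+b₁))`, `j = 1`: the sign is `χ((−det H′_w)·ε^b₁)`.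
[cite: Rogawski1990, §4.3 (4.3.2) p. 43; §3.5 Prop. 3.5.2 (c) p. 29; §4.9 Prop. 4.9.1 p. 55] -/
theorem finKappaAt_eq_ite_of_literal_frame (w : PlacesOver L v) (hw : IsCMField.complexConj L • w.1 = w.1) (hH'w : IsUnit (placeForm H' w.1))
    (A : GL (Fin 3) (w.1.adicCompletion L))
    (hframe : placeForm H' w.1 = (-(placeForm H' w.1).det) •
      formCongr (galAdicCompletionMap (L := L) (IsCMField.complexConj L) hw) A ((StdForm.antidiagonal 3).over (w.1.adicCompletion L)))
    (γH : (cmDatum L 2 (Matrix.of fun i j : Fin 2 => if i.val + j.val + 1 = 2 then (1 : L) else 0)).Local v ×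
      (cmDatum L 1 (Matrix.of fun i j : Fin 1 => if i.val + j.val + 1 = 1 then (1 : L) else 0)).Local v)
    (hu : IsUnit ((finCharpolyTwo L v γH).eval (finGammaTwo L v γH)))
    {t : (cmDatum L 3 H').Local v} (ht : IsLocalNormPair L H' v γH t)
    {P : GL (Fin 3) (w.1.adicCompletion L)} {D : Fin 3 → w.1.adicCompletion L}
    (hPD : formCongr (galAdicCompletionMap (L := L) (IsCMField.complexConj L) hw) P ((StdForm.antidiagonal 3).over (w.1.adicCompletion L)) = diagonal D)
    {x : Fin 3 → w.1.adicCompletion L}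
    (hQ : (((localNonsplitEquiv (IsCMField.complexConj L) H' (IsCMField.complexConj_ne_one L) w hw t).val :
        GL (Fin 3) (w.1.adicCompletion L)) : Matrix (Fin 3) (Fin 3) (w.1.adicCompletion L)) * (A⁻¹ * P).val = (A⁻¹ * P).val * diagonal x)
    (hx : Function.Injective x) (hx1 : ∀ i, galAdicCompletionMap (L := L) (IsCMField.complexConj L) hw (x i) * x i = 1)
    {j : Fin 3} (hj : x j = finGammaTwo L v γH w) :
    finKappaAt L v H' γH t =
      if ∃ z : w.1.adicCompletion L, galAdicCompletionMap (L := L) (IsCMField.complexConj L) hw z * z = (-(placeForm H' w.1).det) * D j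
      then 1 else -1 := by
  rw [finKappaAt_eq_ite_of_onePlace_frame L H' w hw γH hu hH'w ht hQ hx hx1 hj, formCongr_inv_mul_eq_smul_diagonal_of_frame L H' w hw A hframe hPD,
    Matrix.smul_apply, diagonal_apply_eq, smul_eq_mul]

/-- **NORM CLASSES AT A RAMIFIED PLACE HAVE INDEX TWO**: if `ε` is not a norm and every non-zero `σ_w`-fixed `s` is `z σ_w z` or `ε (z σ_w z)` (★ p846845), then for a
non-zero `σ_w`-fixed `a`: `a·ε` is a norm iff `a` is not. [cite: LabesseLanglands1979, §2 pp. 8–9] [cite: Rogawski1990, §3.6 p. 31] -/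
theorem exists_norm_mul_nonNorm_iff (w : PlacesOver L v) (hw : IsCMField.complexConj L • w.1 = w.1) {ε a : w.1.adicCompletion L}
    (hεN : ¬ ∃ s : w.1.adicCompletion L, s * galAdicCompletionMap (L := L) (IsCMField.complexConj L) hw s = ε)
    (hdich : ∀ s : w.1.adicCompletion L, s ≠ 0 → galAdicCompletionMap (L := L) (IsCMField.complexConj L) hw s = s →
      ∃ z : w.1.adicCompletion L, z ≠ 0 ∧
        (s = z * galAdicCompletionMap (L := L) (IsCMField.complexConj L) hw z ∨
          s = ε * (z * galAdicCompletionMap (L := L) (IsCMField.complexConj L) hw z)))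
    (ha0 : a ≠ 0) (hσa : galAdicCompletionMap (L := L) (IsCMField.complexConj L) hw a = a) :
    (∃ z : w.1.adicCompletion L, galAdicCompletionMap (L := L) (IsCMField.complexConj L) hw z * z = a * ε) ↔
      ¬ ∃ z : w.1.adicCompletion L, galAdicCompletionMap (L := L) (IsCMField.complexConj L) hw z * z = a := by
  set σ := galAdicCompletionMap (L := L) (IsCMField.complexConj L) hw
  constructor
  · rintro ⟨z, hz⟩ ⟨z', hz'⟩
    -- `ε = N(z) ∕ N(z′) = N(z ∕ z′)`
    have hz'0 : z' ≠ 0 := fun h0 => ha0 (by rw [← hz', h0, mul_zero])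
    have hσz'0 : σ z' ≠ 0 := (map_ne_zero σ).2 hz'0
    refine hεN ⟨z / z', ?_⟩
    rw [map_div₀, div_mul_div_comm, mul_comm z, mul_comm z', hz, hz', mul_comm a ε, mul_div_assoc, div_self ha0, mul_one]
  · intro hna
    obtain ⟨z, hz0, h | h⟩ := hdich a ha0 hσa
    · exact absurd ⟨z, by rw [mul_comm]; exact h.symm⟩ hna
    · refine ⟨ε * z, ?_⟩
      -- `σ(εz)·(εz) = ε²·N(z) = a·ε`  (`σ ε = ε` since `ε = a ∕ N(z)` is `σ`-fixed)
      have hN0 : z * σ z ≠ 0 := mul_ne_zero hz0 ((map_ne_zero σ).2 hz0)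
      have hε : ε = a / (z * σ z) := by rw [h, mul_div_assoc, div_self hN0, mul_one]
      have hσε : σ ε = ε := by
        rw [hε, map_div₀, hσa, map_mul, show σ (σ z) = z from
          galAdicCompletionMap_galAdicCompletionMap_of_smul_eq (IsCMField.complexConj L) w (IsCMField.complexConj_ne_one L) hw z, mul_comm (σ z)]
      rw [map_mul, hσε, h]; ring

/-- **THE NORM DICHOTOMY HOLDS FOR EVERY NON-NORM `ε`** at a tame-ramified place: from ★ `exists_fixed_unit_norm_dichotomy_of_ramified_complexConj` (some `ε₀` with
`F_v^× = N ∪ ε₀N`) and `ε ∉ N`, `σ_w ε = ε`: every non-zero `σ_w`-fixed `s` is `z σ_w z` or `ε (z σ_w z)`.  (So the consumer of ★ `exists_four_ramified_representatives`,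
which exports only `σ_w ε = ε`, `|ε|_w = 1`, `ε ∉ N`, has the dichotomy for ITS `ε`.) [cite: LabesseLanglands1979, §2 pp. 8–9] [cite: Rogawski1990, §3.6 p. 31] -/
theorem norm_dichotomy_of_not_norm (w : PlacesOver L v) (hw : IsCMField.complexConj L • w.1 = w.1)
    (he : v.asIdeal.ramificationIdx' w.1.asIdeal ≠ 1) (h2 : Valued.v (2 : w.1.adicCompletion L) = 1) {ε : w.1.adicCompletion L}
    (hσε : galAdicCompletionMap (L := L) (IsCMField.complexConj L) hw ε = ε)
    (hεN : ¬ ∃ s : w.1.adicCompletion L, s * galAdicCompletionMap (L := L) (IsCMField.complexConj L) hw s = ε) :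
    ∀ s : w.1.adicCompletion L, s ≠ 0 → galAdicCompletionMap (L := L) (IsCMField.complexConj L) hw s = s →
      ∃ z : w.1.adicCompletion L, z ≠ 0 ∧
        (s = z * galAdicCompletionMap (L := L) (IsCMField.complexConj L) hw z ∨
          s = ε * (z * galAdicCompletionMap (L := L) (IsCMField.complexConj L) hw z)) := by
  set σ := galAdicCompletionMap (L := L) (IsCMField.complexConj L) hw
  obtain ⟨ε₀, -, -, -, -, hdich⟩ := exists_fixed_unit_norm_dichotomy_of_ramified_complexConj L w hw he h2
  have hε0 : ε ≠ 0 := fun h => hεN ⟨0, by rw [h, zero_mul]⟩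
  -- `ε = ε₀ N(z₁)` (the other branch would make `ε` a norm)
  obtain ⟨z₁, hz₁0, hε | hε⟩ := hdich ε hε0 hσε
  · exact absurd ⟨z₁, hε.symm⟩ hεN
  intro s hs0 hσs
  obtain ⟨z, hz0, h | h⟩ := hdich s hs0 hσs
  · exact ⟨z, hz0, Or.inl h⟩
  · -- `s = ε₀ N(z) = ε N(z ∕ z₁)`
    have hN1 : z₁ * σ z₁ ≠ 0 := mul_ne_zero hz₁0 ((map_ne_zero σ).2 hz₁0)
    refine ⟨z / z₁, div_ne_zero hz0 hz₁0, Or.inr ?_⟩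
    rw [map_div₀, div_mul_div_comm, hε, h, mul_assoc, mul_div_assoc', mul_comm (z₁ * σ z₁), mul_div_assoc, div_self hN1, mul_one]

/-- **THE κ-SIGNS OF THE FOUR RAMIFIED REPRESENTATIVES FLIP WITH `b₁`.**  In the setting of ★ `exists_four_ramified_representatives` at a tame-ramified `w` (`ε` σ-fixed, not a norm —
the norm dichotomy for it is `norm_dichotomy_of_not_norm`; `H′` hermitian so that `det H′_w` is `σ_w`-fixed), for a matched `G`-regular `γ_H = (g, u)` and a literal `t` with frame data `(P, (ε^b₀, ε^b₁, −ε^(b₀+b₁)))`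
and `x₁ = u_w`:  `κ_v(γ_H, t) = χ(−det H′_w) · (−1)^b₁`, `χ(a) := if a ∈ N(L_w^×) then 1 else −1`.  So two of the four classes have each sign (★ `ncard_conjClassesIn_sep_finKappaAt_eq_{eq,neg}_two`)
and the certificate's label `κ_b = (−1)^{b₁}` is correct up to the GLOBAL sign `χ(−det H′_w)` of the frame. [cite: Rogawski1990, §4.3 (4.3.2) p. 43; §4.9 Prop. 4.9.1 p. 55; §3.6 p. 31]
[cite: LabesseLanglands1979, §2 pp. 8–9] -/
theorem finKappaAt_ramified_representative_eq (hH' : (H'.map (IsCMField.complexConj L))ᵀ = H')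
    (w : PlacesOver L v) (hw : IsCMField.complexConj L • w.1 = w.1) (hH'w : IsUnit (placeForm H' w.1))
    (A : GL (Fin 3) (w.1.adicCompletion L))
    (hframe : placeForm H' w.1 = (-(placeForm H' w.1).det) •
      formCongr (galAdicCompletionMap (L := L) (IsCMField.complexConj L) hw) A ((StdForm.antidiagonal 3).over (w.1.adicCompletion L)))
    (he : v.asIdeal.ramificationIdx' w.1.asIdeal ≠ 1) (h2 : Valued.v (2 : w.1.adicCompletion L) = 1)
    {ε : w.1.adicCompletion L} (hσε : galAdicCompletionMap (L := L) (IsCMField.complexConj L) hw ε = ε)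
    (hεN : ¬ ∃ s : w.1.adicCompletion L, s * galAdicCompletionMap (L := L) (IsCMField.complexConj L) hw s = ε)
    (γH : (cmDatum L 2 (Matrix.of fun i j : Fin 2 => if i.val + j.val + 1 = 2 then (1 : L) else 0)).Local v ×
      (cmDatum L 1 (Matrix.of fun i j : Fin 1 => if i.val + j.val + 1 = 1 then (1 : L) else 0)).Local v)
    (hu : IsUnit ((finCharpolyTwo L v γH).eval (finGammaTwo L v γH)))
    {t : (cmDatum L 3 H').Local v} (ht : IsLocalNormPair L H' v γH t)
    {P : GL (Fin 3) (w.1.adicCompletion L)} {b₀ b₁ : Fin 2}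
    (hPD : formCongr (galAdicCompletionMap (L := L) (IsCMField.complexConj L) hw) P ((StdForm.antidiagonal 3).over (w.1.adicCompletion L)) =
      diagonal ![ε ^ (b₀ : ℕ), ε ^ (b₁ : ℕ), -(ε ^ ((b₀ : ℕ) + (b₁ : ℕ)))])
    {x : Fin 3 → w.1.adicCompletion L}
    (hQ : (((localNonsplitEquiv (IsCMField.complexConj L) H' (IsCMField.complexConj_ne_one L) w hw t).val :
        GL (Fin 3) (w.1.adicCompletion L)) : Matrix (Fin 3) (Fin 3) (w.1.adicCompletion L)) * (A⁻¹ * P).val = (A⁻¹ * P).val * diagonal x)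
    (hx : Function.Injective x) (hx1 : ∀ i, galAdicCompletionMap (L := L) (IsCMField.complexConj L) hw (x i) * x i = 1)
    (hj : x 1 = finGammaTwo L v γH w) :
    finKappaAt L v H' γH t =
      (if ∃ z : w.1.adicCompletion L, galAdicCompletionMap (L := L) (IsCMField.complexConj L) hw z * z = -(placeForm H' w.1).det then (1 : ℤ) else -1) *
        (-1) ^ (b₁ : ℕ) := by
  rw [finKappaAt_eq_ite_of_literal_frame L H' w hw hH'w A hframe γH hu ht hPD hQ hx hx1 hj,
    show (![ε ^ (b₀ : ℕ), ε ^ (b₁ : ℕ), -(ε ^ ((b₀ : ℕ) + (b₁ : ℕ)))] : Fin 3 → w.1.adicCompletion L) 1 = ε ^ (b₁ : ℕ) from rfl]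
  have hdich := norm_dichotomy_of_not_norm L w hw he h2 hσε hεN
  -- `a = −det H′_w` is non-zero and `σ_w`-fixed
  have ha0 : -(placeForm H' w.1).det ≠ 0 := neg_ne_zero.2 ((Matrix.isUnit_iff_isUnit_det _).1 hH'w).ne_zero
  have hσa : galAdicCompletionMap (L := L) (IsCMField.complexConj L) hw (-(placeForm H' w.1).det) = -(placeForm H' w.1).det := by
    haveI : Algebra.IsQuadraticExtension ↥(maximalRealSubfield L) L := IsCMField.isQuadraticExtension L
    have hh := placeForm_hermitian_of_smul_eq (IsCMField.complexConj L) w H' hH' hw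
    have hdet := congrArg Matrix.det hh
    rw [Matrix.det_transpose, ← RingHom.mapMatrix_apply, ← RingHom.map_det] at hdet
    rw [map_neg, hdet]
  have hb : (b₁ : ℕ) = 0 ∨ (b₁ : ℕ) = 1 := by have := b₁.isLt; omega
  rcases hb with hb | hb
  · rw [hb, pow_zero, mul_one, pow_zero, mul_one]
  · rw [hb, pow_one, pow_one, mul_neg, mul_one]
    by_cases hna : ∃ z : w.1.adicCompletion L, galAdicCompletionMap (L := L) (IsCMField.complexConj L) hw z * z = -(placeForm H' w.1).det
    · have h1 : ¬ ∃ z : w.1.adicCompletion L, galAdicCompletionMap (L := L) (IsCMField.complexConj L) hw z * z = -(placeForm H' w.1).det * ε :=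
        fun h => (exists_norm_mul_nonNorm_iff L w hw hεN hdich ha0 hσa).1 h hna
      rw [if_neg h1, if_pos hna]
    · have h1 : ∃ z : w.1.adicCompletion L, galAdicCompletionMap (L := L) (IsCMField.complexConj L) hw z * z = -(placeForm H' w.1).det * ε :=
        (exists_norm_mul_nonNorm_iff L w hw hεN hdich ha0 hσa).2 hna
      rw [if_pos h1, if_neg hna, neg_neg]

end CM

end Literature.NumberTheory.Rogawski1990

end
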